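import Summits.AnomalousDissipation.AnomalousDissipation.Theses.MomentParity
import Summits.AnomalousDissipation.AnomalousDissipation.Theorems.QuarticGate.Negative.LevelCeiling

/-!
# Crux-ideate sketch (round 1, ideator 1) for `MomentParity.QuarticTightness`
(stmt-AnomalousDissipation-14331). Typed first lemmas of the idea cards
`casimir-gap-ladder` and `flux-pinned-limit`, plus the shared ν-localisation of the crux.
Nothing here is a route item; `sorry`-free (statements are `def … : Prop`, one `Iff.rfl`).
-/

namespace Summit.AnomalousDissipation.AnomalousDissipation.Cruxes.QuarticTightness.Ideate1

open MeasureTheory Filter Topology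
open scoped ENNReal
open Literature.Analysis.FunctionSpaces Literature.Analysis.FluidPDE
open Summit.AnomalousDissipation.AnomalousDissipation.Theses.MomentParity
open Summit.AnomalousDissipation.AnomalousDissipation.Theorems.QuarticGate.Negative

noncomputable section

/-! ## Vocabulary: the conclusion clause of the crux -/

/-- A LADDER WITNESS at `(f, ν, N)` with budgets `E, ε`, support radius `R`, order `d`:
the conclusion clause of `QuarticTightness` (verbatim sub-terms, named). -/
def IsLadderWitness (f : UnitAddTorus (Fin 3) → EuclideanSpace ℝ (Fin 3)) (ν : ℝ) (N : ℕ)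
    (E ε R : ℝ) (d : ℕ) (μ : Measure (Torus.energySpace (Fin 3))) : Prop :=
  IsProbabilityMeasure μ ∧ (∀ᵐ u ∂μ, IsLevel N u) ∧ (∀ᵐ u ∂μ, ‖u‖ ≤ R) ∧
    IsPolyStationary ν f N d μ ∧ Torus.ensembleEnergy μ ≤ E ∧ ε ≤ Torus.ensembleDissipation ν μ

/-- The conclusion body of the crux along a viscosity sequence: Galerkin-loud at all orders with
bounded support, `N`-frequently, at every `j`, with `j`-uniform budgets. -/
def GalerkinLoudAllOrders (f : UnitAddTorus (Fin 3) → EuclideanSpace ℝ (Fin 3)) (ν : ℕ → ℝ)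
    (E' ε' : ℝ) : Prop :=
  ∀ j : ℕ, ∃ R : ℝ, ∃ᶠ N in atTop, ∀ d : ℕ, ∃ μ, IsLadderWitness f (ν j) N E' ε' R d μ

/-- Readback of the crux through the vocabulary (definitional). -/
theorem quarticTightness_iff :
    QuarticTightness ↔
      ∀ f : UnitAddTorus (Fin 3) → EuclideanSpace ℝ (Fin 3),
        Torus.IsSmooth f → Torus.IsDivFree f → Torus.HasZeroMean f →
        ∀ (ν : ℕ → ℝ) (E ε : ℝ), (∀ j, 0 < ν j) → Tendsto ν atTop (𝓝 0) → 0 < ε →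
        (∀ j : ℕ, ∃ᶠ N in atTop, ∃ μ, IsQuarticWitness f (ν j) N E ε μ) →
        ∃ E' ε' : ℝ, 0 < ε' ∧ GalerkinLoudAllOrders f ν E' ε' :=
  Iff.rfl

/-! ## Shared reduction: ν-localisation and the fixed-viscosity floor -/

/-- `QuarticTightness` LOCALISED IN THE VISCOSITY: a per-viscosity transfer "loud order-4 design at
`(ν, E, ε)`, `N`-frequently ⇒ loud bounded ladder at `(ν, E', ε')`, `N`-frequently" with constants
`E', ε'` uniform on `ν ∈ (0, ν₀)`. Equivalent to the crux given `FixedViscosityFloor`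
(`Localisation`). -/
def QuarticTightnessLocal : Prop :=
  ∀ f : UnitAddTorus (Fin 3) → EuclideanSpace ℝ (Fin 3),
    Torus.IsSmooth f → Torus.IsDivFree f → Torus.HasZeroMean f →
    ∀ E ε : ℝ, 0 < ε → ∃ E' ε' ν₀ : ℝ, 0 < ε' ∧ 0 < ν₀ ∧
      ∀ ν : ℝ, 0 < ν → ν < ν₀ →
        (∃ᶠ N in atTop, ∃ μ, IsQuarticWitness f ν N E ε μ) →
        ∃ R : ℝ, ∃ᶠ N in atTop, ∀ d : ℕ, ∃ μ, IsLadderWitness f ν N E' ε' R d μ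

/-- FIXED-VISCOSITY FLOOR (provable now: Dirac at a steady Galerkin state from
`exists_galerkinRHS_eq_zero`, energy `≤ ‖f‖²/(16π⁴ν²)`, and the residual estimate
`‖P_N f‖_{V'} ≤ ν‖∇u_N‖ + C‖∇u_N‖²` giving `ν‖∇u_N‖² ≥ c(f, ν) > 0` for `N ≥ N_f`): at each fixed
viscosity the conclusion of the crux holds with `ν`-DEPENDENT budgets. All difficulty of the crux
is `ν`-uniformity. -/
def FixedViscosityFloor : Prop :=
  ∀ f : UnitAddTorus (Fin 3) → EuclideanSpace ℝ (Fin 3),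
    Torus.IsSmooth f → Torus.IsDivFree f → Torus.HasZeroMean f → f ≠ 0 →
    ∀ ν : ℝ, 0 < ν → ∃ E' ε' R : ℝ, 0 < ε' ∧
      ∀ᶠ N in atTop, ∀ d : ℕ, ∃ μ, IsLadderWitness f ν N E' ε' R d μ

/-- The localisation lemma (pure logic + the floor + the in-tree energy row `ε ≤ ‖f‖₂√E`, which
forces `f ≠ 0` and `ν ≤ ν₁(f,E,ε)` whenever a design exists). -/
def Localisation : Prop :=
  FixedViscosityFloor → (QuarticTightness ↔ QuarticTightnessLocal)

/-! ## Card `casimir-gap-ladder`: first lemmas -/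

/-- SPHERE–LIOUVILLE SIGN LEMMA. The Galerkin–Euler derivative `{p, E_N}(u) = ∫ (u⊗u) : ∇(∇p(u))`
(= `nsGeneratorPairing 0 0 u (polyGrad g P u)`) of a polynomial cylindrical observable with
level-`N` band tests, if non-negative on a level-`N` energy sphere `‖u‖ = r`, vanishes on it.
(Galerkin–Euler is divergence free on `V_N` and tangent to energy spheres, so it preserves the
normalised surface measure of `S_r ∩ V_N`; a continuous non-negative function with zero mean for a
full-support measure vanishes.) The BALL-local replacement of the Gaussian sign lemma of line
`recession-cone`; provable now. -/
def SphereSignLemma : Prop :=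
  ∀ (N m : ℕ) (g : Fin m → UnitAddTorus (Fin 3) → EuclideanSpace ℝ (Fin 3))
    (P : MvPolynomial (Fin m) ℝ) (r : ℝ), (∀ i, IsBandTest N (g i)) →
    (∀ u : Torus.energySpace (Fin 3), IsLevel N u → ‖u‖ = r →
      0 ≤ Torus.nsGeneratorPairing 0 0 u (polyGrad g P u)) →
    ∀ u : Torus.energySpace (Fin 3), IsLevel N u → ‖u‖ = r →
      Torus.nsGeneratorPairing 0 0 u (polyGrad g P u) = 0

/-- BOUNDED-SUPPORT SELF-IMPROVEMENT (the `d = 4` rung of the localised conclusion; first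
conjectural step of the ladder): a loud order-4 design family at `(ν, E, ε)` can be re-realised,
`N`-frequently, INSIDE a ball of radius `R = R(f, ν, E, ε)` independent of `N`, at budgets
`(2E, ε/2)`. Content: the far antipodal atoms of line `recession-cone` can be parked at an
`N`-uniform radius iff the cubic-row defect functional is represented by Euler-derivative
evaluations with `N`-uniformly bounded total weight — a quantitative, `N`-uniform
"no cubic Casimir" (the Casimir gap `σ₃(N) ≥ σ > 0`). -/
def BoundedSupportSelfImprovement : Prop :=
  ∀ f : UnitAddTorus (Fin 3) → EuclideanSpace ℝ (Fin 3),
    Torus.IsSmooth f → Torus.IsDivFree f → Torus.HasZeroMean f →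
    ∀ (ν E ε : ℝ), 0 < ν → 0 < ε →
      (∃ᶠ N in atTop, ∃ μ, IsQuarticWitness f ν N E ε μ) →
      ∃ R : ℝ, ∃ᶠ N in atTop, ∃ μ, IsLadderWitness f ν N (2 * E) (ε / 2) R 4 μ

/-- ONE RUNG OF THE LADDER IN A FIXED BALL (the inductive statement the line must prove with
constants GEOMETRIC in `d`; as typed here only the qualitative rung): at fixed `(f, ν)` and a
radius `R` chosen once, loud `d`-stationary level-`N` laws in `B_R` upgrade to loud
`(d+1)`-stationary ones in the SAME ball at a budget loss `(E_d, ε_d) ↦ (E_{d+1}, ε_{d+1})`.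
By `MomentClosure` the rungs for all `d` with `sup E_d < ∞`, `inf ε_d > 0` give a loud invariant
law, so the rung constants ARE the zeroth law for `f`; the line isolates them in the Casimir gaps
`σ_d(N)` and the row-defect growth. -/
def LadderRung (f : UnitAddTorus (Fin 3) → EuclideanSpace ℝ (Fin 3)) (ν R : ℝ)
    (E ε : ℕ → ℝ) (d : ℕ) : Prop :=
  (∃ᶠ N in atTop, ∃ μ, IsLadderWitness f ν N (E d) (ε d) R d μ) →
    ∃ᶠ N in atTop, ∃ μ, IsLadderWitness f ν N (E (d + 1)) (ε (d + 1)) R (d + 1) μ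

/-! ## Card `flux-pinned-limit`: first lemma -/

/-- FLUX PINNING (provable now; it is the quadratic row of `P = Σ Xᵢ²` over the level-`k` frame
plus the energy row). For a 3-stationary level-`N` law, the mean energy flux out of the modes
`|k'| ≤ k`, `Π_μ(k) = ⟨(B(u,u), P_k u)⟩ = −∫ nsGeneratorPairing 0 0 u (P_k u) dμ`, equals the
mean dissipation above `k` up to the tail of the force:
`|Π_μ(k) − ν⟨‖∇(u − P_k u)‖²⟩| ≤ ‖f − P_k f‖₂ · (ensembleEnergy μ)^{1/2}`.
Hence QUIET bounded invariant laws (dissipation `→ 0`) are FLUX-FREE beyond the force band,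
uniformly in `N`: the limit objects of `¬`(conclusion) are flux-free finite-energy Euler ensembles. -/
def FluxPinning : Prop :=
  ∀ f : UnitAddTorus (Fin 3) → EuclideanSpace ℝ (Fin 3),
    Torus.IsSmooth f → Torus.IsDivFree f → Torus.HasZeroMean f →
    ∀ (ν : ℝ) (N k : ℕ) (μ : Measure (Torus.energySpace (Fin 3))), 0 < ν → k ≤ N →
      IsProbabilityMeasure μ → (∀ᵐ u ∂μ, IsLevel N u) →
      Integrable (fun u : Torus.energySpace (Fin 3) => ‖u‖ ^ 3) μ →
      IsPolyStationary ν f N 3 μ →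
      |(∫ u, Torus.nsGeneratorPairing 0 0 u
            (Torus.fourierTruncate k (u.1 : UnitAddTorus (Fin 3) → EuclideanSpace ℝ (Fin 3))) ∂μ) +
          ν * (∫⁻ u, Torus.eGradNormSq (fun x =>
            (u.1 : UnitAddTorus (Fin 3) → EuclideanSpace ℝ (Fin 3)) x -
              Torus.fourierTruncate k (u.1 : UnitAddTorus (Fin 3) → EuclideanSpace ℝ (Fin 3)) x) ∂μ).toReal|
        ≤ Real.sqrt (∫ x, ‖f x - Torus.fourierTruncate k f x‖ ^ 2) *
            Real.sqrt (Torus.ensembleEnergy μ)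

/-- STRESS PINNING (provable now; the linear rows tested against `A⁻¹`-smoothed band fields):
for a 2-stationary level-`N` law with energy `≤ E`, the full second moment balances the force up to
`O(ν)`: for every band test `g`, `|∫ nsGeneratorPairing 0 0 u g dμ + ∫(f, g)| ≤ ν ‖Δg‖₂ √E`, i.e.
`P_N div⟨u ⊗ u⟩ = P_N f + O(ν√E)` weakly. Quiet or loud, bounded laws carry an `O(1)` Reynolds
stress pinned to the force; loudness is the `O(1)` question whether the mean flow does work. -/
def StressPinning : Prop :=
  ∀ f : UnitAddTorus (Fin 3) → EuclideanSpace ℝ (Fin 3),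
    Torus.IsSmooth f → Torus.IsDivFree f → Torus.HasZeroMean f →
    ∀ (ν E : ℝ) (N : ℕ) (μ : Measure (Torus.energySpace (Fin 3)))
      (g : UnitAddTorus (Fin 3) → EuclideanSpace ℝ (Fin 3)), 0 < ν → IsBandTest N g →
      IsProbabilityMeasure μ → (∀ᵐ u ∂μ, IsLevel N u) →
      Integrable (fun u : Torus.energySpace (Fin 3) => ‖u‖ ^ 2) μ →
      IsPolyStationary ν f N 2 μ → Torus.ensembleEnergy μ ≤ E →
      |(∫ u, Torus.nsGeneratorPairing 0 0 u g ∂μ) + ∫ x, inner ℝ (f x) (g x)|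
        ≤ ν * Real.sqrt (∫ x, ‖Torus.laplacian g x‖ ^ 2) * Real.sqrt E

end

end Summit.AnomalousDissipation.AnomalousDissipation.Cruxes.QuarticTightness.Ideate1
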